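/-
Copyright (c) 2026 the pub-hodgecm-mathlib formalisation cell (harness21).  Prover seat hodgecm-mathlib-K2Liu-p05 (g0): Track B «K2-LIT»,
#184♮ = hLiu418 = stmt-HodgeConjecture-24832; sockets #32d∕#32dR `sig_K2LiuDoublingHeightDecayLocal(R2)` of `Cruxes/HLiu418/Lines/K2_Liu_CurveThetaSigs_U5d_ZetaS.lean`
— THE FINITE SLICE AT A SPLIT PLACE, UNCONDITIONALLY; K2/STATUS 2026-09-04 (K2Liu-p05 (g0)).
-/
import Summits.HodgeConjecture.HodgeConjecture.Theorems.K2LiuSplitSliceOfTorusDecay     -- ★ slice ⇐ local torus decay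
import Summits.HodgeConjecture.HodgeConjecture.Theorems.K2LiuSplitTorusDecay            -- ★ (D) the local torus decay at any split place
import Summits.HodgeConjecture.HodgeConjecture.Theorems.K2LiuCartanFamilySplit          -- ★ `coe_cartanSplit_apply`, the split frame `e_w`
import Literature.NumberTheory.Automorphic.GJUnfoldingLocal                             -- ★ `norm_eq_inv_residueCard_of_valued_eq`
import Literature.NumberTheory.Automorphic.AdicCompletionResidueCard                    -- ★ `natCard_valuativeResidueField_adicCompletion_eq`
import HarnessLib

/-!
# Crux `HLiu418`, road `K2_Liu`, unit U5d, sockets #32d∕#32dR — THE FINITE SLICE OF THE DOUBLING HEIGHT DECAY AT A SPLIT PLACE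

Cell `hodgecm-mathlib`, crux item hLiu418 = `stmt-HodgeConjecture-24832`; squad K2 ∕ K2Liu, LEAD F0P6-plan (g10), prover K2Liu-p05 (g0).  THEOREMS ONLY
(no `def` ∕ instance ∕ notation ∕ named-fact hypothesis ∕ `sorry`, default heartbeats); lane `--supports stmt-HodgeConjecture-24832 --as helper`.

THE STATEMENT (`integrable_placeSlice_split`).  In the frame of #32d (`M = 1`: `e : Fin N × Fin 1 ≃ Fin n`, `dW : Fin 1 → L`; `t ht g hg ιA hιA`, finite `S`,
a Haar measure `ν` on `G_v = U(H)(L⁺_v)`, a continuous height `Φ > 0` of type `(P_Δ, modDelta)`), for `v ∈ S` SPLIT in `L ∕ L⁺` (`w ∣ v`, `c w ≠ w`) and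
`0 < τ`, `2N − 2 < τ`:
  `Integrable (fun u => Φ (iotaLeft L e dV hdV dW hdW (ιA (placesEmbed L H S (1, Pi.mulSingle v u)))) ^ τ) ν`
— the hypothesis `_hfin v` of ★ (R) `doublingHeightDecayLocal_of_slices`, with NO good-place hypothesis on `v`.
Assembly: ★ `integrable_placeSlice_of_localTorusDecay` at the split frame `e_w = localPiSplitEquiv` (★ `K2LiuCartanFamilySplit`) with the torus decay
★ (D) `exists_torusDecay_split` (`r = ‖ϖ‖^{1∕2}`), ★ `coe_cartanSplit_apply` (`(e_w⁻¹ ϖ^a)_w = diag(ϖ^{a_i})`), and `‖ϖ‖ = q_w⁻¹` (★ `norm_eq_inv_residueCard_of_valued_eq`,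
★ `natCard_valuativeResidueField_adicCompletion_eq`), so that `r^τ q_w^{N−1} = q_w^{(N−1)−τ∕2} < 1 ⟺ τ > 2N − 2`.
What remains of #32dR (N = 2) after this file: the archimedean slice (★-pending `K2LiuDoublingHeightArchSlice`, K2Liu-p02) and the finite slices at the
NON-split `v ∈ S` (anisotropic: compact; quasi-split `U(1,1)`: the rank-one Cartan package, K2Liu-p01 row 26).
[GelbartPiatetskishapiroRallis1987, Part A §6]; [Li1992, §3 Thm. 3.1]; [Liu2011, §2C (2-4) p. 863]; [Macdonald1995, Ch. V §2].
HONEST LABEL.  Count-neutral helper: `HC_CM` is proved only modulo the 7 printed citations (2 remaining named inputs: hLiu418 = `stmt-HodgeConjecture-24832`,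
h413 = `stmt-HodgeConjecture-24833`) until rung 0 closes.
-/

set_option autoImplicit false
-- the mandated namespace repeats the single-problem summit's segment (`HodgeConjecture.HodgeConjecture`)
set_option linter.dupNamespace false

noncomputable section

open scoped Matrix ENNReal
open NumberField IsDedekindDomain MeasureTheory Matrix

namespace Summit.HodgeConjecture.HodgeConjecture.Cruxes.HLiu418.K2LiuSplitSliceIntegrable

open Literature.NumberTheory.Automorphic Literature.NumberTheory.Automorphic.UnitaryGroup
open Literature.NumberTheory.GelbartRogawski1991 Literature.NumberTheory.GelbartRogawski1991.GRConstruction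
open Literature.NumberTheory.K2Lit Literature.NumberTheory.K2Lit.SiegelDoubled Literature.NumberTheory.K2Lit.PlaceSplitting
open ValuativeRel
open Summit.HodgeConjecture.HodgeConjecture.Cruxes.HLiu418.K2LiuSplitSliceOfTorusDecay
open Summit.HodgeConjecture.HodgeConjecture.Cruxes.HLiu418.K2LiuSplitTorusDecay
open Summit.HodgeConjecture.HodgeConjecture.Cruxes.HLiu418.K2LiuCartanFamilySplit

variable (L : Type) [Field L] [NumberField L] [IsCMField L]
variable {N n : ℕ} (e : Fin N × Fin 1 ≃ Fin n)
  (dV : Fin N → L) (hdV : ∀ i, IsCMField.complexConj L (dV i) = dV i)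
  (dW : Fin 1 → L) (hdW : ∀ i, IsCMField.complexConj L (dW i) = dW i)
  (H : Matrix (Fin N) (Fin N) L) (t : L) (ht : t ≠ 0) (g : GL (Fin N) L)
  (hg : formCongr ((IsCMField.complexConj L : L ≃ₐ[↥(maximalRealSubfield L)] L) : L →+* L) g (t • H) = Matrix.diagonal dV)
  (ιA : (UnitaryGroup.adelicGroupData (Fp L) L (IsCMField.complexConj L) N H).Adelic →*
    UnitaryGroup.adelic (Fp L) L (IsCMField.complexConj L) N (Matrix.diagonal dV))
  (hιA : ∀ k, ((ιA k : ↥(UnitaryGroup.adelic (Fp L) L (IsCMField.complexConj L) N (Matrix.diagonal dV))) :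
        GL (Fin N) (AdeleRing (𝓞 L) L)) =
      (toAdeleGL L g)⁻¹ * UnitaryGroup.adelicVal (Fp L) L (IsCMField.complexConj L) N H k * toAdeleGL L g)
  (S : Finset (HeightOneSpectrum (𝓞 (Fp L)))) [DecidableEq (HeightOneSpectrum (𝓞 (Fp L)))]

omit [IsCMField L] [DecidableEq (HeightOneSpectrum (𝓞 (Fp L)))] in
/-- the sharp-exponent numerics at a finite place: `‖ϖ‖ = q_w⁻¹`, so `(‖ϖ‖^{1∕2})^τ · q_w^{N−1} < 1` as soon as `0 < τ` and `2N − 2 < τ`.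
[cite: GelbartPiatetskishapiroRallis1987, Part A §6] [cite: Li1992, §3 Thm. 3.1] -/
theorem rpow_norm_uniformizer_mul_pow_lt_one {w : HeightOneSpectrum (𝓞 L)} {ϖ : w.adicCompletion L}
    (hϖ : Valued.v ϖ = WithZero.exp (-1 : ℤ)) {τ : ℝ} (hτ0 : 0 < τ) (hτ : 2 * (N : ℝ) - 2 < τ) :
    (‖ϖ‖ ^ (((1 : ℕ) : ℝ) / 2)) ^ τ * (Nat.card 𝓀[w.adicCompletion L] : ℝ) ^ (N - 1) < 1 := by
  have hq1 : 1 < w.residueCard := w.one_lt_residueCard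
  have hq : (1 : ℝ) < (w.residueCard : ℝ) := by exact_mod_cast hq1
  have hq0 : (0 : ℝ) < (w.residueCard : ℝ) := zero_lt_one.trans hq
  rw [natCard_valuativeResidueField_adicCompletion_eq L w, norm_eq_inv_residueCard_of_valued_eq hϖ, Nat.cast_one,
    Real.inv_rpow hq0.le, Real.inv_rpow (Real.rpow_nonneg hq0.le _), ← Real.rpow_mul hq0.le, ← Real.rpow_neg hq0.le,
    ← Real.rpow_natCast, ← Real.rpow_add hq0]
  refine Real.rpow_lt_one_of_one_lt_of_neg hq ?_
  rcases Nat.eq_zero_or_pos N with hN | hN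
  · subst hN
    simp only [Nat.zero_sub, Nat.cast_zero, add_zero, neg_lt_zero]
    positivity
  · rw [Nat.cast_sub hN, Nat.cast_one]
    linarith

include ht hg hιA in
/-- **THE FINITE SLICE OF #32d∕#32dR AT A SPLIT PLACE `v ∈ S`** (see the module docstring): for `0 < τ` and `2N − 2 < τ`,
`u ↦ Φ(ι(ιA(placesEmbed_S(1, u at v))))^τ` is integrable on `U(H)(L⁺_v)` — at ANY split place, good or bad.
[cite: GelbartPiatetskishapiroRallis1987, Part A §6] [cite: Li1992, §3 Thm. 3.1] [cite: Liu2011, §2C (2-4) p. 863] [cite: Macdonald1995, Ch. V §2 (2.9)] -/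
theorem integrable_placeSlice_split (hdV0 : ∀ i, dV i ≠ 0) (hdW0 : ∀ i, dW i ≠ 0) (v : S)
    [MeasurableSpace (UnitaryGroup.localPi L (IsCMField.complexConj L) N H v.1)]
    [BorelSpace (UnitaryGroup.localPi L (IsCMField.complexConj L) N H v.1)]
    (ν : Measure (UnitaryGroup.localPi L (IsCMField.complexConj L) N H v.1)) [ν.IsHaarMeasure]
    {Φ : HA L e dV hdV dW hdW → ℝ} (hΦc : Continuous Φ) (hΦpos : ∀ x, 0 < Φ x)
    (hΦ : ∀ p x : HA L e dV hdV dW hdW, IsSiegelDelta L e dV hdV dW hdW p →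
      Φ (p * x) = modDelta L e dV hdV dW hdW p * Φ x)
    (w : UnitaryGroup.PlacesOver L v.1) (hw : IsCMField.complexConj L • w.1 ≠ w.1)
    {ϖ : w.1.adicCompletion L} (hϖ : Valued.v ϖ = WithZero.exp (-1 : ℤ))
    {τ : ℝ} (hτ0 : 0 < τ) (hτ : 2 * (N : ℝ) - 2 < τ) :
    Integrable (fun u => Φ (iotaLeft L e dV hdV dW hdW (ιA (placesEmbed L H S (1, Pi.mulSingle v u)))) ^ τ) ν := by
  haveI : Algebra.IsQuadraticExtension (Fp L) L := IsCMField.isQuadraticExtension L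
  -- the split frame `e_w : U(diag dV)(L⁺_v) ≃ₜ* GL_N(L_w)` and the uniformizing element
  have hϖU : IsUniformizingElement ϖ := isUniformizingElement_of_valued_eq L w.1 hϖ
  let e' := UnitaryGroup.localPiSplitEquiv (IsCMField.complexConj L) (Matrix.diagonal dV) (IsCMField.complexConj_ne_one L)
    (transpose_map_diagonal L dV hdV) w hw (isUnit_placeForm_diagonal L dV hdV0 w.1)
  -- (D): the torus decay at `v`, with `r = ‖ϖ‖^{1∕2}`
  obtain ⟨C, -, hdec⟩ := exists_torusDecay_split L e dV hdV dW hdW v.1 hdV0 hdW0 w hw hϖ hΦc hΦpos hΦ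
  exact integrable_placeSlice_of_localTorusDecay L e dV hdV dW hdW H t ht g hg ιA hιA S hdV0 hdW0 v ν hΦc hΦpos hΦ hϖU e'
    (isOpen_glInt_adicCompletion N L w.1) (isCompact_glInt_adicCompletion N L w.1) hτ0 (C := C)
    (Real.rpow_nonneg (norm_nonneg ϖ) _) (rpow_norm_uniformizer_mul_pow_lt_one L hϖ hτ0 hτ)
    fun a => hdec a _ (coe_cartanSplit_apply L dV hdV hdV0 v.1 w hw hϖ a)

end Summit.HodgeConjecture.HodgeConjecture.Cruxes.HLiu418.K2LiuSplitSliceIntegrable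

end
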